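import Summits.CriticalPhenomena.CardyFormulaZ2.Theorems.CardyIKTransportCornerLineDescentFreezeHomogenisation
import Summits.CriticalPhenomena.CardyFormulaZ2.Theorems.CardyIKTransportCornerLineDescentCrudeContinuity
import Literature.Probability.Percolation.QuadCrossingContinuityEventsDischarge
import Literature.Probability.RandomPlanarGeometry.ImageUnivalent

/-!
# The frozen end of the corner line, CLOSED: `FreezeToStandard` (crux `CardyIKTransport.CornerLineDescent`)

Support file (`--supports stmt-CriticalPhenomena-10964`, registered sub-goal `stub_FreezeToStandard`) for the line
`symmetric-seed-second-order` of the crux `CardyIKTransport.CornerLineDescent`.  THE PLANNER'S STUB 5 IS NOW A THEOREM: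
Cardy's formula (in the crude `embDomainCrossing` reading, every conformal rectangle) for the FROZEN GAUGE `p = 0` —
bond-`ℤ²` at `½` on the random renewal grid (XOR colourings, i.i.d. geometric gaps of mean `2`, fair coins) — implies
Cardy's formula for STANDARD bond-`ℤ²` at `½` in every conformal rectangle, with NO hypothesis left.  Composition of
landed pieces: the renewal-grid coupling / SLLN / sandwich reduction `stub_FreezeHomogenisation_of_continuity`
(`…FreezeHomogenisation.lean`, p93823), the crude-continuity bridge `stub_CrudeCrossingContinuity_of_SS`
(`…CrudeContinuity.lean`, p95499), the DISCHARGED named fact `QuadCrossing.SchrammSmirnov2011_lemma_5_1_holds`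
(`Literature/Probability/Percolation/QuadCrossingContinuityEventsDischarge.lean`, p99052; Schramm–Smirnov 2011 Lemma 5.1
for bond-`ℤ²`, proved by the four-move assembly over the charted Lemma 6.1 moves), and the similarity glue
`freezeToStandard_of_homogenisation` (the checked skeleton's, inlined here: limit transfer on the rotated rectangle
`e^{iπ/4}·R` through `MarkedDomain.IsUniformizing.image_data`).  With this file the line `symmetric-seed-second-order`
has exactly two open registered stubs, the dense and dilute signed-influence estimates.
References: route file `Theses/CardyIKTransport.lean` (item 10964); Schramm–Smirnov, Ann. Probab. 39 (2011) §5–6.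
-/

noncomputable section

namespace Summit.CriticalPhenomena.CardyFormulaZ2.Theorems.CornerLineDescent.SymmetricSeed

open scoped Topology
open Filter
open Literature.Probability.RandomPlanarGeometry

/-- THE FREEZE GLUE (the checked skeleton's `freezeToStandard_of_homogenisation`, landed here): limit transfer on the
rotated rectangle.  Given Cardy for the frozen gauge in EVERY conformal rectangle, apply it to `e^{iπ/4}·R` with the
transported uniformizing datum `(e^{iπ/4} ∘ φ, x)` (same real boundary preimages `x`, `MarkedDomain.IsUniformizing.image_data`),
then transfer the limit `F(crossRatio x)` to the standard family of `R`. [folklore] -/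
theorem freezeToStandard_of_homogenisation'
    (h : ∀ (R : ConformalRectangle) (L : ℝ),
      Tendsto (gaugeCrossingProb 0
          (R.map (Homeomorph.mulLeft₀ (Complex.exp (((Real.pi / 4 : ℝ) : ℂ) * Complex.I)) (Complex.exp_ne_zero _))))
        (𝓝[>] 0) (𝓝 L) →
      Tendsto (bondStdCrossingProb R) (𝓝[>] 0) (𝓝 L)) :
    (∀ R : ConformalRectangle, R.HasCrossingLimit (gaugeCrossingProb 0 R) cardyFunction) →
      ∀ R : ConformalRectangle, R.HasCrossingLimit (bondStdCrossingProb R) cardyFunction := by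
  intro hg R φ x hφx
  set c : ℂ := Complex.exp (((Real.pi / 4 : ℝ) : ℂ) * Complex.I) with hc
  have hc0 : c ≠ 0 := Complex.exp_ne_zero _
  have hψ := hφx.image_data (S := R.map (Homeomorph.mulLeft₀ c hc0)) (h := fun z => c * z)
    ((differentiable_id.const_mul c).differentiableOn) (mul_right_injective₀ hc0).injOn
    (continuous_const.mul continuous_id).continuousOn rfl fun _ => rfl
  exact h R _ (hg _ _ x hψ)

/-- `stub_FreezeToStandard` (the planner's stub 5 of the line, now PROVED UNCONDITIONALLY): Cardy's formula for the frozen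
gauge `p = 0` (bond-`ℤ²` at `½` on the random renewal grid) in every conformal rectangle implies Cardy's formula for standard
bond-`ℤ²` at `½` in every conformal rectangle — `freezeToStandard_of_homogenisation'` ∘ `stub_FreezeHomogenisation_of_continuity`
∘ `stub_CrudeCrossingContinuity_of_SS` ∘ `SchrammSmirnov2011_lemma_5_1_holds`. [folklore] -/
theorem stub_FreezeToStandard :
    (∀ R : ConformalRectangle, R.HasCrossingLimit (gaugeCrossingProb 0 R) cardyFunction) →
      ∀ R : ConformalRectangle, R.HasCrossingLimit (bondStdCrossingProb R) cardyFunction :=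
  freezeToStandard_of_homogenisation'
    (stub_FreezeHomogenisation_of_continuity
      (stub_CrudeCrossingContinuity_of_SS
        Literature.Probability.Percolation.QuadCrossing.SchrammSmirnov2011_lemma_5_1_holds))

end Summit.CriticalPhenomena.CardyFormulaZ2.Theorems.CornerLineDescent.SymmetricSeed
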